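/-
Copyright (c) 2026 the pub-hodgecm-mathlib formalisation cell (harness21).  Prover seat hodgecm-mathlib-K2Liu-p05 (g7), Track B «K2-LIT»,
hLiu418 = stmt-HodgeConjecture-24832: socket #42S, organ S5 OF RECORD ED. 5 — the tie hole `hK0` («KIND-0 ORGAN OUTPUTS AT THE CARRIER + organ (M)'s ray law») made
ONE NAME (LEAD F0P6-plan (g14) BATCH #100 (1); R90-C10-p06 (g2) 2026-09-04T22:41:27Z).  THEOREMS ONLY (no `def`, no `instance`, no notation, no named-fact hypothesis,
no `sorry`); NO `Lines` import.
-/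
import Summits.HodgeConjecture.HodgeConjecture.Theorems.K2LiuIncoherentConstantTermPackage     -- ★ (K0c) p862627 (R90-C10-p06) `exists_constantTerm_package_incoherent`
import Summits.HodgeConjecture.HodgeConjecture.Theorems.K2LiuSiegelMiddleTermCentralRay        -- ★ (M) p862532 (K2Liu-p05) `middleTerm_centralRay`
import Summits.HodgeConjecture.HodgeConjecture.Theorems.K2LiuIntertwiningDeltaUnconditional   -- ★ `exists_leviHom_blk_eq` (a Levi homomorphism `Λ` by value)
import Summits.HodgeConjecture.HodgeConjecture.Theorems.K2LiuSiegelMiddleCellSortedPattern     -- ★ α2b `exists_reflStd` (the middle reflection `g₀`)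
import HarnessLib

/-!
# Crux `HLiu418`, road `K2_Liu`, socket #42S — `K2LiuIncoherentKindZeroOutputsOfRecord`: THE `hK0` LETTER OF ★ ED. 5 `incoherentFamily_firstTerm_zero_of_packages₅`,
# BY NAME — the KIND-0 organ outputs `E₈`, `E₇` at the incoherent carrier (★ (K0c)) WITH the middle cell's central-ray law `(r, c₇, hray₇)` (★ (M))

Cell `hodgecm-mathlib`, crux item hLiu418 = `stmt-HodgeConjecture-24832`; squad K2, LEAD F0P6-plan (g14) BATCH #100 (1) «`hK0_of_organs` — GO»; prover K2Liu-p05 (g7).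
Lane `--kind proof --supports stmt-HodgeConjecture-24832 --as helper` (count-neutral helper; closes no socket by itself).

THE POINT.  ★ ED. 5 `K2LiuIncoherentZeroResidueOfRecordEdFive.incoherentFamily_firstTerm_zero_of_packages₅` (R90-C10-p06, p862634) carries the hypothesis
`hK0 : ∀ carrier (νN, β, hβ, hβ0, hβtop, K, hK, hβK) (wq, hwq), ∃ E₈ E₇ r c₇, (i)₈ ∧ (iv)₈ ∧ (i)₇ ∧ (iv)₇ ∧ r ≠ 1 ∧ c₇ ≠ 1 ∧ hray₇` — the KIND-0 organ outputs at `f := g_{S,G}`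
(prefix `{½}`) and the middle cell's central-ray law on `{n∕2 < re}`.  ★ (K0c) `exists_constantTerm_package_incoherent` pays `(E₈, E₇, (i)(iv)×2)` from the #41 TOP's KIND-0
organ INPUTS by value; ★ (M) `K2LiuSiegelMiddleTermCentralRay.middleTerm_centralRay` (literal `Fin 2` frame) gives the ray law of the un-normalised middle term with the
`s`-INDEPENDENT eigenvalue `|z(r)|_𝔸`.  THIS FILE glues them: `n = 2` is forced by `e : Fin 2 × Fin 1 ≃ Fin n` (`Fintype.card_congr e`, `subst`), the (M) frame letters are
BUILT here (★ α2b `exists_reflStd` → `g₀`, ★ `exists_leviHom_blk_eq` → `Λ`, ★ F4-2b `exists_stabilizer_subgroupOf` → `Γ₀ = Stab(⟦w₀⟧)`), `r := 2`, `c₇ := |z(2)|_𝔸 = 2^{[L:ℚ]} ≠ 1`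
(★ `ideleNorm_posRealIdele_holds`), and `hray₇` is (M) glued through (K0c)'s clause (iv)₇ — the scalar `(∫β)⁻¹ •` and the prefix `(s − ½)` commute with the ray law.
HEAD **`hK0_of_organs`**: binders = ★ (K0c)'s VERBATIM (context `(L e dV hdV hdV0 dW hdW hdW0 χ hχ 𝒦 h𝒦 χb hχbu hχbs α hα hαrat hχD eW e' dV₀ hdV₀ hdV₀0 S hχS hKS G hINC)`, carrier
`[MeasurableSpace] [BorelSpace] (νN) [IsHaar] (β) (hβ)` **+ `(hβtop)`**, `{K} (hK) (hβK)`, `(wq)` **+ `(hwq)`**, the KIND-0 organ inputs `hS₈ … hMID`), NO pole set (prefix `{½}` fixed);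
conclusion = ★ ED. 5's `hK0` consequent :237–254 BYTE-FOR-BYTE.  TIE RECIPE: `hK0 := fun _ _ νN _ β hβ _hβ0 hβtop K hK hβK wq hwq => hK0_of_organs L e … hINC νN β hβ hβtop hK hβK wq hwq hS₈ … c₀ hMID`.
References: [MoeglinWaldspurger1995] II.1.7, IV.1.8–IV.1.9; [KudlaRallis1994] §1–§2; [Tan1999] §4 Props. 4.1, 4.8; [GanQiuTakeda2014] §6.4 Prop. 15; [JiangWu2016ChiB] Prop. 4.1.
HONEST LABEL.  Count-neutral helper: `HC_CM` is proved only modulo the 7 printed citations (2 remaining named inputs: hLiu418 = `stmt-HodgeConjecture-24832`,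
h413 = `stmt-HodgeConjecture-24833`) until rung 0 closes.
-/

set_option autoImplicit false
set_option linter.dupNamespace false -- the mandated namespace repeats `HodgeConjecture.HodgeConjecture`

noncomputable section

open scoped Matrix TensorProduct Classical Topology ENNReal NNReal BigOperators
open NumberField NumberField.InfinitePlace IsDedekindDomain Filter MeasureTheory
open Literature.RepresentationTheory.HeisenbergGroup
open Literature.NumberTheory.QuadraticForms
open Literature.NumberTheory.Automorphic Literature.NumberTheory.Automorphic.UnitaryGroup Literature.NumberTheory.GaloisRepresentations
open Literature.NumberTheory.Automorphic.IdeleClassGroup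
open Literature.NumberTheory.LFunctions
open Literature.NumberTheory.Weil1964 Literature.RepresentationTheory.HarrisKudlaSweet1996
open Literature.NumberTheory.GelbartRogawski1991 Literature.NumberTheory.GelbartRogawski1991.GRConstruction Literature.NumberTheory.GelbartRogawski1991.UnitaryDualPair
open Literature.NumberTheory.GelbartRogawski1991.UnitaryDualPair.LocalSplitting
open Literature.NumberTheory.GelbartRogawski1991.GRConstruction.DoubledWeilDetTwist
open Literature.NumberTheory.GelbartRogawski1991.AdaptedBlocks
open Literature.NumberTheory.K2Lit.SiegelDoubled Literature.NumberTheory.K2Lit.LocalSiegelDoubled Literature.MeasureTheory.Group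
open Literature.NumberTheory.Automorphic.Liu2021.Def411WeilCarriersDoubling (doubledWeilRep isDoubledWeilRep_doubledWeilRep)
open Summit.HodgeConjecture.HodgeConjecture.Cruxes.HLiu418.K2LiuLocalSWSectionDefs Summit.HodgeConjecture.HodgeConjecture.Cruxes.HLiu418.K2LiuLocalSWImageDefs
open Summit.HodgeConjecture.HodgeConjecture.Cruxes.HLiu418.K2LiuSWSectionPlaceFactorisation
open Summit.HodgeConjecture.HodgeConjecture.Cruxes.HLiu418.K2LiuIncoherentPatternFamily Summit.HodgeConjecture.HodgeConjecture.Cruxes.HLiu418.K2LiuIncoherentPatternFamilyRecord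
open Summit.HodgeConjecture.HodgeConjecture.Cruxes.HLiu418.K2LiuSiegelSectionDetTwist
open Summit.HodgeConjecture.HodgeConjecture.Cruxes.HLiu418.K2LiuSiegelUnipotentFourierDefs
open Summit.HodgeConjecture.HodgeConjecture.Cruxes.HLiu418.K2LiuQRationalDefs (IsQRationalRegularAt)
open Summit.HodgeConjecture.HodgeConjecture.Cruxes.HLiu418.K2LiuGL2FlatSectionFiniteData (ofFinite_mem)

namespace Summit.HodgeConjecture.HodgeConjecture.Cruxes.HLiu418.K2LiuIncoherentKindZeroOutputsOfRecord

open K2LiuIncoherentConstantTermPackage (exists_constantTerm_package_incoherent)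
open K2LiuSiegelMiddleTermCentralRay (middleTerm_centralRay)
open K2LiuIntertwiningDeltaUnconditional (exists_leviHom_blk_eq)
open K2LiuSiegelMiddleCellSortedPattern (exists_reflStd)
open K2LiuSiegelQuotSubgroupOrbitUnfold (exists_stabilizer_subgroupOf)
open K2LiuSiegelBruhatMiddleCellDelta (iotaGG_one_mem_ratH)

set_option maxHeartbeats 2000000 in -- MEASURED (= ★ (K0c) ∕ ★ ED. 1–5 of the S5 organ, same statement block): the record pattern `hINC` times out `whnf` at the default 200000
/-- **THE `hK0` LETTER OF ★ ED. 5, BY NAME.**  Binders: ★ (K0c)'s context, carrier (+ `hβtop`), `wq` (+ `hwq`) and KIND-0 organ inputs VERBATIM; conclusion = ★ ED. 5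
`incoherentFamily_firstTerm_zero_of_packages₅`'s `hK0` consequent BYTE-FOR-BYTE: `∃ E₈ E₇ r c₇, (i)₈ ∧ (iv)₈ ∧ (i)₇ ∧ (iv)₇ ∧ r ≠ 1 ∧ c₇ ≠ 1 ∧ hray₇` (★ (K0c) at `P := {½}`;
`r := 2`, `c₇ := |z(2)|_𝔸`; `hray₇` = ★ (M) `middleTerm_centralRay` glued through (iv)₇, frame letters `g₀ Λ Γ₀` built inside).
[cite: MoeglinWaldspurger1995, II.1.7] [cite: KudlaRallis1994, §2 (2.10)–(2.12)] [cite: Tan1999, §4 Prop. 4.8] [cite: JiangWu2016ChiB, Prop. 4.1] -/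
theorem hK0_of_organs
    (L : Type) [Field L] [NumberField L] [IsCMField L] {n : ℕ} (e : Fin 2 × Fin 1 ≃ Fin n)
    (dV : Fin 2 → L) (hdV : ∀ i, IsCMField.complexConj L (dV i) = dV i) (hdV0 : ∀ i, dV i ≠ 0)
    (dW : Fin 1 → L) (hdW : ∀ i, IsCMField.complexConj L (dW i) = dW i) (hdW0 : ∀ i, dW i ≠ 0)
    (χ : HeckeCharacter L) (hχ : χ.IsUnitary) (𝒦 : IwasawaDatum L e dV hdV dW hdW) (h𝒦 : 𝒦.IsStd)
    -- the det-twist data BY VALUE (assembler's bytes)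
    (χb : HeckeCharacter L) (hχbu : χb.IsUnitary) (hχbs : IsSplittingChar L 1 χb)
    (α : UnitaryGroup.adelicOne (Fp L) L (IsCMField.complexConj L) →* ℂˣ) (hα : Continuous α)
    (hαrat : ∀ u : UnitaryGroup.adelicOne (Fp L) L (IsCMField.complexConj L), (u : ideleGroup L) ∈ principalIdeles L → α u = 1)
    (hχD : χb ^ 3 * ratioHecke L α hα hαrat = χ)
    -- the frames BY VALUE (assembler's bytes)
    {M' n' : ℕ} (eW : Fin 1 × Fin 3 ≃ Fin M') (e' : Fin 2 × Fin M' ≃ Fin n')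
    (dV₀ : Fin 3 → L) (hdV₀ : ∀ k, IsCMField.complexConj L (dV₀ k) = dV₀ k) (hdV₀0 : ∀ k, dV₀ k ≠ 0)
    -- ONE `(S, G)`: the good-place guards (the assembler's `hχS`, `hKS` at its use site) and the incoherent pattern (`hS5`'s antecedent, bytes verbatim)
    (S : Finset (HeightOneSpectrum (𝓞 (Fp L))))
    (hχS : ∀ v, v ∉ S → ∀ w' : PlacesOver L v, (χb ^ 3).IsUnramifiedAt w'.1)
    (hKS : ∀ k ∈ 𝒦.K, ∀ v, v ∉ S → UnitaryGroup.evalPlace (Fp L) L (IsCMField.complexConj L) (n + n) (hermD L e dV hdV dW hdW) v (UnitaryGroup.finPart (Fp L) L (IsCMField.complexConj L) (n + n) (hermD L e dV hdV dW hdW) k) ∈ UnitaryGroup.localInt L (IsCMField.complexConj L) (n + n) (hermD L e dV hdV dW hdW) v)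
    (G : HA L e dV hdV dW hdW → ℂ)
    (hINC : ∃ (T : Finset (InfinitePlace (Fp L))) (t : Finset (HeightOneSpectrum (𝓞 (Fp L)))) (A : UnitaryGroup.arch (Fp L) L (IsCMField.complexConj L) (n + n) (hermD L e dV hdV dW hdW) → ℂ)
        (b : ∀ v : HeightOneSpectrum (𝓞 (Fp L)), (UnitaryGroup.localPi L (IsCMField.complexConj L) (n + n) (hermD L e dV hdV dW hdW) v → ℂ))
        (c₁ : (Fp L)ˣ) (dV₁ : Fin 3 → L) (hdV₁ : ∀ k, IsCMField.complexConj L (dV₁ k) = dV₁ k) (hdV₁0 : ∀ k, dV₁ k ≠ 0),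
        t ⊆ S ∧ (∀ k, dV₁ k = ((c₁ : Fp L) : L) * dV₀ k) ∧
        (∀ v ∈ S \ t, ¬ IsSquare (algebraMap (Fp L) (v.adicCompletion (Fp L)) (cmQuadraticGenerator L : Fp L)) ∧ hilbertSymbol (v.adicCompletion (Fp L)) (algebraMap (Fp L) _ ((c₁ : (Fp L)ˣ) : Fp L)) (algebraMap (Fp L) _ (cmQuadraticGenerator L : Fp L)) = -1) ∧
        ¬ Even ((S \ t).card + T.card) ∧
        (∀ c : (Fp L)ˣ, (∀ w : InfinitePlace (Fp L), hilbertSymbol w.Completion (algebraMap (Fp L) _ ((c : (Fp L)ˣ) : Fp L)) (algebraMap (Fp L) _ (cmQuadraticGenerator L : Fp L)) = -1 ↔ w ∈ T) →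
            ∀ (dVc : Fin 3 → L) (hdVc : ∀ k, IsCMField.complexConj L (dVc k) = dVc k) (hdVc0 : ∀ k, dVc k ≠ 0),
            (∀ k, dVc k = ((c : Fp L) : L) * dV₀ k) →
            ∃ V : Submodule ℂ (SchwartzMap (Fin (n' + n') → mixedEmbedding.mixedSpace (Fp L)) ℂ), FiniteDimensional ℂ V ∧
              (∀ ainf : UnitaryGroup.arch (Fp L) L (IsCMField.complexConj L) (n + n) (hermD L e dV hdV dW hdW),
                (UnitaryGroup.archToAdelic (Fp L) L (IsCMField.complexConj L) (n + n) (hermD L e dV hdV dW hdW) ainf : HA L e dV hdV dW hdW) ∈ 𝒦.K →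
                ∀ a ∈ V, ∃ a' ∈ V, ∀ f : FinSB (Fp L) (Fin (n' + n')),
                  adelicMpCont.omega (Fp L) (Fin (n' + n')) (gramDA L e' dV hdV (tensorFrame L dW eW dVc) (tensorFrame_real L dW hdW eW dVc hdVc))
                      ((doubledWeilRep L e' dV hdV hdV0 (tensorFrame L dW eW dVc) (tensorFrame_real L dW hdW eW dVc hdVc) (tensorFrame_ne_zero L dW eW dVc hdW0 hdVc0) χb hχbu hχbs) (tensorEmb L e dV hdV dW hdW eW e' dVc hdVc
                        (UnitaryGroup.archToAdelic (Fp L) L (IsCMField.complexConj L) (n + n) (hermD L e dV hdV dW hdW) ainf)))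
                      (piSchwartzBruhatEquiv (Fp L) (Fin (n' + n')) (a ⊗ₜ[ℂ] f)) =
                    piSchwartzBruhatEquiv (Fp L) (Fin (n' + n')) (a' ⊗ₜ[ℂ] f)) ∧
              ∃ Φinf ∈ V, ∃ Ys : LocalSBFamily (Fp L) (Fin (n' + n')),
                (∀ v : HeightOneSpectrum (𝓞 (Fp L)),
                  swSectionTensorLoc L e dV hdV dW hdW eW e' dVc hdVc v ((finSplittings L e' dV hdV hdV0 (tensorFrame L dW eW dVc) (tensorFrame_real L dW hdW eW dVc hdVc) (tensorFrame_ne_zero L dW eW dVc hdW0 hdVc0) χb (borelPlaceMeasure L) (cmFinLocalFamily L e' dV hdV hdV0 (tensorFrame L dW eW dVc) (tensorFrame_real L dW hdW eW dVc hdVc) (tensorFrame_ne_zero L dW eW dVc hdW0 hdVc0) χb hχbs (borelPlaceMeasure L))).s v)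
                    ⟨(ratSpLoc (Fp L) (n' + n') (gramD L e' dV hdV (tensorFrame L dW eW dVc) (tensorFrame_real L dW hdW eW dVc hdVc))
                          (isUnit_det_gramD L e' dV hdV hdV0 (tensorFrame L dW eW dVc) (tensorFrame_real L dW hdW eW dVc hdVc) (tensorFrame_ne_zero L dW eW dVc hdW0 hdVc0)) v (deltaD L),
                        deltaImpl L e' dV hdV hdV0 (tensorFrame L dW eW dVc) (tensorFrame_real L dW hdW eW dVc hdVc) (tensorFrame_ne_zero L dW eW dVc hdW0 hdVc0) χb (borelPlaceMeasure L) (cmFinLocalFamily L e' dV hdV hdV0 (tensorFrame L dW eW dVc) (tensorFrame_real L dW hdW eW dVc hdVc) (tensorFrame_ne_zero L dW eW dVc hdW0 hdVc0) χb hχbs (borelPlaceMeasure L)) v),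
                      deltaPair_mem_localMp L e' dV hdV hdV0 (tensorFrame L dW eW dVc) (tensorFrame_real L dW hdW eW dVc hdVc) (tensorFrame_ne_zero L dW eW dVc hdW0 hdVc0) χb (borelPlaceMeasure L) (cmFinLocalFamily L e' dV hdV hdV0 (tensorFrame L dW eW dVc) (tensorFrame_real L dW hdW eW dVc hdVc) (tensorFrame_ne_zero L dW eW dVc hdW0 hdVc0) χb hχbs (borelPlaceMeasure L)) v⟩
                    (Ys v) 1 = 1) ∧
                ∀ a : UnitaryGroup.arch (Fp L) L (IsCMField.complexConj L) (n + n) (hermD L e dV hdV dW hdW),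
                  swSectionTensor L e dV hdV dW hdW eW e' dVc hdVc hdV0 hdW0 hdVc0 (doubledWeilRep L e' dV hdV hdV0 (tensorFrame L dW eW dVc) (tensorFrame_real L dW hdW eW dVc hdVc) (tensorFrame_ne_zero L dW eW dVc hdW0 hdVc0) χb hχbu hχbs)
                    (piSchwartzBruhatEquiv (Fp L) (Fin (n' + n')) (Φinf ⊗ₜ piProdSB (Fp L) (Fin (n' + n')) Ys))
                    (UnitaryGroup.archToAdelic (Fp L) L (IsCMField.complexConj L) (n + n) (hermD L e dV hdV dW hdW) a) = A a) ∧
        (∀ v ∈ t, b v ∈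
            localSWImage L e dV hdV dW hdW eW e' dV₀ hdV₀ v ((finSplittings L e' dV hdV hdV0 (tensorFrame L dW eW dV₀) (tensorFrame_real L dW hdW eW dV₀ hdV₀) (tensorFrame_ne_zero L dW eW dV₀ hdW0 hdV₀0) χb (borelPlaceMeasure L) (cmFinLocalFamily L e' dV hdV hdV0 (tensorFrame L dW eW dV₀) (tensorFrame_real L dW hdW eW dV₀ hdV₀) (tensorFrame_ne_zero L dW eW dV₀ hdW0 hdV₀0) χb hχbs (borelPlaceMeasure L))).s v)
              ⟨(ratSpLoc (Fp L) (n' + n') (gramD L e' dV hdV (tensorFrame L dW eW dV₀) (tensorFrame_real L dW hdW eW dV₀ hdV₀))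
                    (isUnit_det_gramD L e' dV hdV hdV0 (tensorFrame L dW eW dV₀) (tensorFrame_real L dW hdW eW dV₀ hdV₀) (tensorFrame_ne_zero L dW eW dV₀ hdW0 hdV₀0)) v (deltaD L),
                  deltaImpl L e' dV hdV hdV0 (tensorFrame L dW eW dV₀) (tensorFrame_real L dW hdW eW dV₀ hdV₀) (tensorFrame_ne_zero L dW eW dV₀ hdW0 hdV₀0) χb (borelPlaceMeasure L) (cmFinLocalFamily L e' dV hdV hdV0 (tensorFrame L dW eW dV₀) (tensorFrame_real L dW hdW eW dV₀ hdV₀) (tensorFrame_ne_zero L dW eW dV₀ hdW0 hdV₀0) χb hχbs (borelPlaceMeasure L)) v),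
                deltaPair_mem_localMp L e' dV hdV hdV0 (tensorFrame L dW eW dV₀) (tensorFrame_real L dW hdW eW dV₀ hdV₀) (tensorFrame_ne_zero L dW eW dV₀ hdW0 hdV₀0) χb (borelPlaceMeasure L) (cmFinLocalFamily L e' dV hdV hdV0 (tensorFrame L dW eW dV₀) (tensorFrame_real L dW hdW eW dV₀ hdV₀) (tensorFrame_ne_zero L dW eW dV₀ hdW0 hdV₀0) χb hχbs (borelPlaceMeasure L)) v⟩) ∧
        (∀ v ∈ S \ t, b v ∈
            localSWImage L e dV hdV dW hdW eW e' dV₁ hdV₁ v ((finSplittings L e' dV hdV hdV0 (tensorFrame L dW eW dV₁) (tensorFrame_real L dW hdW eW dV₁ hdV₁) (tensorFrame_ne_zero L dW eW dV₁ hdW0 hdV₁0) χb (borelPlaceMeasure L) (cmFinLocalFamily L e' dV hdV hdV0 (tensorFrame L dW eW dV₁) (tensorFrame_real L dW hdW eW dV₁ hdV₁) (tensorFrame_ne_zero L dW eW dV₁ hdW0 hdV₁0) χb hχbs (borelPlaceMeasure L))).s v)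
              ⟨(ratSpLoc (Fp L) (n' + n') (gramD L e' dV hdV (tensorFrame L dW eW dV₁) (tensorFrame_real L dW hdW eW dV₁ hdV₁))
                    (isUnit_det_gramD L e' dV hdV hdV0 (tensorFrame L dW eW dV₁) (tensorFrame_real L dW hdW eW dV₁ hdV₁) (tensorFrame_ne_zero L dW eW dV₁ hdW0 hdV₁0)) v (deltaD L),
                  deltaImpl L e' dV hdV hdV0 (tensorFrame L dW eW dV₁) (tensorFrame_real L dW hdW eW dV₁ hdV₁) (tensorFrame_ne_zero L dW eW dV₁ hdW0 hdV₁0) χb (borelPlaceMeasure L) (cmFinLocalFamily L e' dV hdV hdV0 (tensorFrame L dW eW dV₁) (tensorFrame_real L dW hdW eW dV₁ hdV₁) (tensorFrame_ne_zero L dW eW dV₁ hdW0 hdV₁0) χb hχbs (borelPlaceMeasure L)) v),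
                deltaPair_mem_localMp L e' dV hdV hdV0 (tensorFrame L dW eW dV₁) (tensorFrame_real L dW hdW eW dV₁ hdV₁) (tensorFrame_ne_zero L dW eW dV₁ hdW0 hdV₁0) χb (borelPlaceMeasure L) (cmFinLocalFamily L e' dV hdV hdV0 (tensorFrame L dW eW dV₁) (tensorFrame_real L dW hdW eW dV₁ hdV₁) (tensorFrame_ne_zero L dW eW dV₁ hdW0 hdV₁0) χb hχbs (borelPlaceMeasure L)) v⟩) ∧
        (∀ v, v ∉ S → LambdaLoc L e dV hdV dW hdW v (χb ^ 3) ((((3 : ℕ) : ℂ) - (n : ℂ)) / 2) ∈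
            localSWImage L e dV hdV dW hdW eW e' dV₀ hdV₀ v ((finSplittings L e' dV hdV hdV0 (tensorFrame L dW eW dV₀) (tensorFrame_real L dW hdW eW dV₀ hdV₀) (tensorFrame_ne_zero L dW eW dV₀ hdW0 hdV₀0) χb (borelPlaceMeasure L) (cmFinLocalFamily L e' dV hdV hdV0 (tensorFrame L dW eW dV₀) (tensorFrame_real L dW hdW eW dV₀ hdV₀) (tensorFrame_ne_zero L dW eW dV₀ hdW0 hdV₀0) χb hχbs (borelPlaceMeasure L))).s v)
              ⟨(ratSpLoc (Fp L) (n' + n') (gramD L e' dV hdV (tensorFrame L dW eW dV₀) (tensorFrame_real L dW hdW eW dV₀ hdV₀))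
                    (isUnit_det_gramD L e' dV hdV hdV0 (tensorFrame L dW eW dV₀) (tensorFrame_real L dW hdW eW dV₀ hdV₀) (tensorFrame_ne_zero L dW eW dV₀ hdW0 hdV₀0)) v (deltaD L),
                  deltaImpl L e' dV hdV hdV0 (tensorFrame L dW eW dV₀) (tensorFrame_real L dW hdW eW dV₀ hdV₀) (tensorFrame_ne_zero L dW eW dV₀ hdW0 hdV₀0) χb (borelPlaceMeasure L) (cmFinLocalFamily L e' dV hdV hdV0 (tensorFrame L dW eW dV₀) (tensorFrame_real L dW hdW eW dV₀ hdV₀) (tensorFrame_ne_zero L dW eW dV₀ hdW0 hdV₀0) χb hχbs (borelPlaceMeasure L)) v),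
                deltaPair_mem_localMp L e' dV hdV hdV0 (tensorFrame L dW eW dV₀) (tensorFrame_real L dW hdW eW dV₀ hdV₀) (tensorFrame_ne_zero L dW eW dV₀ hdW0 hdV₀0) χb (borelPlaceMeasure L) (cmFinLocalFamily L e' dV hdV hdV0 (tensorFrame L dW eW dV₀) (tensorFrame_real L dW hdW eW dV₀ hdV₀) (tensorFrame_ne_zero L dW eW dV₀ hdW0 hdV₀0) χb hχbs (borelPlaceMeasure L)) v⟩) ∧
        ∀ h : HA L e dV hdV dW hdW, G h = (A (UnitaryGroup.archPart (Fp L) L (IsCMField.complexConj L) (n + n) (hermD L e dV hdV dW hdW) h) * ∏ v ∈ S, b v (UnitaryGroup.evalPlace (Fp L) L (IsCMField.complexConj L) (n + n) (hermD L e dV hdV dW hdW) v (UnitaryGroup.finPart (Fp L) L (IsCMField.complexConj L) (n + n) (hermD L e dV hdV dW hdW) h))) *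
          ∏ᶠ v : {v : HeightOneSpectrum (𝓞 (Fp L)) // v ∉ S},
            LambdaLoc L e dV hdV dW hdW v.1 (χb ^ 3) ((((3 : ℕ) : ℂ) - (n : ℂ)) / 2)
              (UnitaryGroup.evalPlace (Fp L) L (IsCMField.complexConj L) (n + n) (hermD L e dV hdV dW hdW) v.1 (UnitaryGroup.finPart (Fp L) L (IsCMField.complexConj L) (n + n) (hermD L e dV hdV dW hdW) h)))
    -- the carrier (the tie's `hK0` λ-binders: `νN β hβ _ hβtop K hK hβK`)
    [MeasurableSpace (unipDelta L e dV hdV dW hdW)] [BorelSpace (unipDelta L e dV hdV dW hdW)]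
    (νN : Measure (unipDelta L e dV hdV dW hdW)) [νN.IsHaarMeasure]
    (β : unipDelta L e dV hdV dW hdW → ℝ≥0∞) (hβ : IsCoveringWeight (unipDeltaRat L e dV hdV dW hdW) β) (hβtop : ∫⁻ u, β u ∂νN ≠ ∞)
    {K : Set (unipDelta L e dV hdV dW hdW)} (hK : IsCompact K) (hβK : ∀ u, β u ≤ K.indicator 1 u)
    -- the rational Weyl presentation of ★ O41.4 (the tie's `hK0` λ-binders `wq hwq`)
    (wq : unipDeltaRat L e dV hdV dW hdW → ratH L e dV hdV dW hdW)
    (hwq : ∀ ν, ((wq ν : ratH L e dV hdV dW hdW) : HA L e dV hdV dW hdW) = weylDelta L e dV hdV dW hdW * ((ν : unipDelta L e dV hdV dW hdW) : HA L e dV hdV dW hdW))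
    -- KIND 0 ORGAN INPUTS BY VALUE = ★ (K0c)'s binders VERBATIM
    {S₈ : Set (HeightOneSpectrum (𝓞 ↥(maximalRealSubfield L)))} (hS₈ : S₈.Finite) (hur : ∀ v ∉ S₈, (quadraticHeckeCharCM L).IsUnramifiedAt v)
    -- KIND 0 big cell: ★ p862134 (K2Liu-p13) SUMMED FACES BY VALUE, per `κ ∈ K`: exceptional places `P₈ κ` off `S₈`, pure-tensor index `I₈ κ`, bad-place index `TF κ` with residue
    -- sizes `q`, the arch∕good blocks `A₈ κ i` (holomorphic), per-place letters `c₈ κ v` (holomorphic) and `N₈ κ i v` (q-rationally regular), the EULER-FACE IDENTITY `hB` (a SUM of pure tensors)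
    (P₈ : ↥𝒦.K → Finset (HeightOneSpectrum (𝓞 ↥(maximalRealSubfield L)))) (hPS : ∀ κ, ∀ v ∈ P₈ κ, v ∉ S₈)
    {ι₈ ι₈' : Type*} (I₈ : ↥𝒦.K → Finset ι₈') (TF : ↥𝒦.K → Finset ι₈) (q : ι₈ → ℕ) (hq : ∀ κ, ∀ v ∈ TF κ, q v ≠ 0)
    (A₈ : ↥𝒦.K → ι₈' → ℂ → ℂ) (hA₈ : ∀ κ, ∀ i ∈ I₈ κ, DifferentiableOn ℂ (A₈ κ i) {s : ℂ | 0 < s.re})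
    (c₈ : ↥𝒦.K → ι₈ → ℂ → ℂ) (hc₈ : ∀ κ, ∀ v ∈ TF κ, DifferentiableOn ℂ (c₈ κ v) {s : ℂ | 0 < s.re})
    (N₈ : ↥𝒦.K → ι₈' → ι₈ → ℂ → ℂ) (hN₈ : ∀ κ, ∀ i ∈ I₈ κ, ∀ v ∈ TF κ, ∀ s₀ : ℂ, 0 < s₀.re → IsQRationalRegularAt (q v) s₀ (N₈ κ i v))
    (hB : ∀ (κ : ↥𝒦.K) (s : ℂ), 1 < s.re →
      (partialStandardL (S₈ ∪ (↑(P₈ κ) : Set (HeightOneSpectrum (𝓞 ↥(maximalRealSubfield L))))) (fun _ => {1}) (2 * s + 1) *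
            partialStandardL (S₈ ∪ (↑(P₈ κ) : Set (HeightOneSpectrum (𝓞 ↥(maximalRealSubfield L))))) (fun v => {(quadraticHeckeCharCM L).valueAtUniformizer v}) (2 * s + 2)) /
          (partialStandardL (S₈ ∪ (↑(P₈ κ) : Set (HeightOneSpectrum (𝓞 ↥(maximalRealSubfield L))))) (fun _ => {1}) (2 * s) *
            partialStandardL (S₈ ∪ (↑(P₈ κ) : Set (HeightOneSpectrum (𝓞 ↥(maximalRealSubfield L))))) (fun v => {(quadraticHeckeCharCM L).valueAtUniformizer v}) (2 * s - 1)) *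
        intertwiningDelta L e dV hdV dW hdW νN ((fun s h => ((detChar L e dV hdV hdV0 dW hdW hdW0 α h : ℂˣ) : ℂ) * stdExtension 𝒦 ((((3 : ℕ) : ℂ) - (n : ℂ)) / 2) G s h) s) (κ : HA L e dV hdV dW hdW) = ∑ i ∈ I₈ κ, A₈ κ i s * ∏ v ∈ TF κ, (c₈ κ v s * N₈ κ i v s))
    -- KIND 0 middle term: ★ p861968 (K2E4-p11) I4 ED. 2 letters BY VALUE — level data, the K-type package `W`, the inner family `φ`, Levi map `mx`, line representatives `γ₇`,
    -- the identification `hMID` of the un-normalised middle term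
    (S₇ : Finset (HeightOneSpectrum (𝓞 L))) (γl : ∀ v : HeightOneSpectrum (𝓞 L), ValuativeRel.ValueGroupWithZero (v.adicCompletion L))
    (hγ0 : ∀ v ∈ S₇, γl v ≠ 0) (hγ1 : ∀ v ∈ S₇, γl v < 1)
    (W : Submodule ℂ (↥(standardMaximalCompactGL 2 L) → ℂ)) [FiniteDimensional ℂ W]
    (hWstab : ∀ B ∈ W, ∀ k₀ : ↥(standardMaximalCompactGL 2 L), (fun k => B (k * k₀)) ∈ W)
    (hWlaw : ∀ B ∈ W, ∀ p k : ↥(standardMaximalCompactGL 2 L),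
    ((p : GL (Fin 2) (AdeleRing (𝓞 L) L)) : Matrix (Fin 2) (Fin 2) (AdeleRing (𝓞 L) L)) 1 0 = 0 → B (p * k) = B k)
    (hWlev : ∀ B ∈ W, ∀ (k : ↥(standardMaximalCompactGL 2 L)) (r : GL (Fin 2) (FiniteAdeleRing (𝓞 L) L)) (hr : r ∈ glFiniteIntegralLevel 2 L),
    (∀ v ∈ S₇, GLn.evalAt 2 L v r ∈ congruenceGL 2 (γl v)) →
      B ⟨(k : GL (Fin 2) (AdeleRing (𝓞 L) L)) * GLn.ofFinite 2 L r, (standardMaximalCompactGL 2 L).mul_mem k.2 (ofFinite_mem hr)⟩ = B k)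
    (hWcont : ∀ B ∈ W, Continuous B)
    (hWext : ∀ B ∈ W, ∃ bB : ℂ → GL (Fin 2) (AdeleRing (𝓞 L) L) → ℂ,
    (∀ s : ℂ, 0 < s.re → ∀ (d : Fin 2 → (AdeleRing (𝓞 L) L)ˣ) (g : GL (Fin 2) (AdeleRing (𝓞 L) L)),
      bB s (glDiagonal 2 (AdeleRing (𝓞 L) L) d * g) =
        ((IdeleClassGroup.ideleNorm L (d 0) : ℝ) : ℂ) ^ (s + 1 / 2) * ((IdeleClassGroup.ideleNorm L (d 1) : ℝ) : ℂ) ^ (-(s + 1 / 2)) * bB s g) ∧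
    (∀ s : ℂ, 0 < s.re → ∀ u g : GL (Fin 2) (AdeleRing (𝓞 L) L), (u : Matrix (Fin 2) (Fin 2) (AdeleRing (𝓞 L) L)) 1 0 = 0 →
      (u : Matrix (Fin 2) (Fin 2) (AdeleRing (𝓞 L) L)) 0 0 = 1 → (u : Matrix (Fin 2) (Fin 2) (AdeleRing (𝓞 L) L)) 1 1 = 1 → bB s (u * g) = bB s g) ∧
    (∀ s : ℂ, 0 < s.re → ∀ (k : GL (Fin 2) (AdeleRing (𝓞 L) L)) (hk : k ∈ standardMaximalCompactGL 2 L), bB s k = B ⟨k, hk⟩))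
    (φ : ℂ → HA L e dV hdV dW hdW → GL (Fin 2) (AdeleRing (𝓞 L) L) → ℂ)
    (hφT : ∀ (s : ℂ) (x : HA L e dV hdV dW hdW), 0 < s.re → ∀ (d : Fin 2 → (AdeleRing (𝓞 L) L)ˣ) (g : GL (Fin 2) (AdeleRing (𝓞 L) L)),
    φ s x (glDiagonal 2 (AdeleRing (𝓞 L) L) d * g) =
      ((IdeleClassGroup.ideleNorm L (d 0) : ℝ) : ℂ) ^ (s + 1 / 2) * ((IdeleClassGroup.ideleNorm L (d 1) : ℝ) : ℂ) ^ (-(s + 1 / 2)) * φ s x g)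
    (hφN : ∀ (s : ℂ) (x : HA L e dV hdV dW hdW), 0 < s.re → ∀ u g : GL (Fin 2) (AdeleRing (𝓞 L) L), (u : Matrix (Fin 2) (Fin 2) (AdeleRing (𝓞 L) L)) 1 0 = 0 →
    (u : Matrix (Fin 2) (Fin 2) (AdeleRing (𝓞 L) L)) 0 0 = 1 → (u : Matrix (Fin 2) (Fin 2) (AdeleRing (𝓞 L) L)) 1 1 = 1 → φ s x (u * g) = φ s x g)
    (hφW : ∀ (s : ℂ) (x : HA L e dV hdV dW hdW), 0 < s.re → (fun k : ↥(standardMaximalCompactGL 2 L) => φ s x k) ∈ W)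
    (hφhol : ∀ (x : HA L e dV hdV dW hdW) (k : ↥(standardMaximalCompactGL 2 L)), DifferentiableOn ℂ (fun s => φ s x k) {s : ℂ | 0 < s.re})
    (hφbd : ∀ z : ℂ, 0 < z.re → ∃ C A r : ℝ, 0 ≤ C ∧ 0 ≤ A ∧ 0 < r ∧ ∀ s : ℂ, dist s z < r →
    ∀ (x : HA L e dV hdV dW hdW) (k : ↥(standardMaximalCompactGL 2 L)), ‖φ s x k‖ ≤ C * adelicHeightGL (n + n) L (x : GL (Fin (n + n)) (AdeleRing (𝓞 L) L)) ^ A)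
    (mx : HA L e dV hdV dW hdW → GL (Fin 2) (AdeleRing (𝓞 L) L)) {C₀ A₀ : ℝ} (hC₀ : 0 ≤ C₀) (hA₀ : 0 ≤ A₀)
    (hmx : ∀ x : HA L e dV hdV dW hdW, adelicHeightGL 2 L (mx x) ≤ C₀ * adelicHeightGL (n + n) L (x : GL (Fin (n + n)) (AdeleRing (𝓞 L) L)) ^ A₀)
    (γ₇ : Projectivization L (Fin 2 → L) → GL (Fin 2) L)
    (hγ : ∀ p, ∃ cL : L, cL ≠ 0 ∧ (Pi.single 1 1 : Fin 2 → L) ᵥ* (γ₇ p : Matrix (Fin 2) (Fin 2) L) = cL • p.rep)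
    (c₀ : ℂ)
    (hMID : ∀ (s : ℂ) (h : HA L e dV hdV dW hdW), (n : ℝ) / 2 < s.re →
      (∫ u, (β u).toReal •
        (∑' q : ↥(({Quotient.mk (MulAction.orbitRel (siegelDeltaRat L e dV hdV dW hdW) (ratH L e dV hdV dW hdW)) 1} ∪
            Set.range (fun ν : unipDeltaRat L e dV hdV dW hdW =>
              (Quotient.mk (MulAction.orbitRel (siegelDeltaRat L e dV hdV dW hdW) (ratH L e dV hdV dW hdW)) (wq ν) :
                SiegelDeltaQuot L e dV hdV dW hdW)))ᶜ : Set (SiegelDeltaQuot L e dV hdV dW hdW)),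
          (fun s h => ((detChar L e dV hdV hdV0 dW hdW hdW0 α h : ℂˣ) : ℂ) * stdExtension 𝒦 ((((3 : ℕ) : ℂ) - (n : ℂ)) / 2) G s h) s ((((Quotient.out (q : SiegelDeltaQuot L e dV hdV dW hdW) : ratH L e dV hdV dW hdW) : HA L e dV hdV dW hdW)) *
            ((u : HA L e dV hdV dW hdW) * h))) ∂νN) =
        c₀ * ∑' p : Projectivization L (Fin 2 → L), φ s h (Matrix.GeneralLinearGroup.map (algebraMap L (AdeleRing (𝓞 L) L)) (γ₇ p) * mx h)) :
        ∃ (E₈ E₇ : ℂ → HA L e dV hdV dW hdW → ℂ) (r : ℝ≥0ˣ) (c₇ : ℂ),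
          (∀ h : HA L e dV hdV dW hdW, DifferentiableOn ℂ (fun s => E₈ s h) {s : ℂ | 0 < s.re}) ∧
          (∀ (s : ℂ) (h : HA L e dV hdV dW hdW), (n : ℝ) / 2 < s.re →
            E₈ s h = (∏ p ∈ ({(1 / 2 : ℂ)} : Finset ℂ), (s - p)) * (((∫⁻ u, β u ∂νN).toReal⁻¹ : ℝ) • intertwiningDelta L e dV hdV dW hdW νN (fun h => ((detChar L e dV hdV hdV0 dW hdW hdW0 α h : ℂˣ) : ℂ) * stdExtension 𝒦 ((((3 : ℕ) : ℂ) - (n : ℂ)) / 2) G s h) h)) ∧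
          (∀ h : HA L e dV hdV dW hdW, DifferentiableOn ℂ (fun s => E₇ s h) {s : ℂ | 0 < s.re}) ∧
          (∀ (s : ℂ) (h : HA L e dV hdV dW hdW), (n : ℝ) / 2 < s.re →
            E₇ s h = (∏ p ∈ ({(1 / 2 : ℂ)} : Finset ℂ), (s - p)) * (((∫⁻ u, β u ∂νN).toReal⁻¹ : ℝ) • ∫ u, (β u).toReal •
              (∑' q : ↥(({Quotient.mk (MulAction.orbitRel (siegelDeltaRat L e dV hdV dW hdW) (ratH L e dV hdV dW hdW)) 1} ∪
            Set.range (fun ν : unipDeltaRat L e dV hdV dW hdW =>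
              (Quotient.mk (MulAction.orbitRel (siegelDeltaRat L e dV hdV dW hdW) (ratH L e dV hdV dW hdW)) (wq ν) :
                SiegelDeltaQuot L e dV hdV dW hdW)))ᶜ : Set (SiegelDeltaQuot L e dV hdV dW hdW)),
          ((detChar L e dV hdV hdV0 dW hdW hdW0 α ((((Quotient.out (q : SiegelDeltaQuot L e dV hdV dW hdW) : ratH L e dV hdV dW hdW) : HA L e dV hdV dW hdW)) * ((u : HA L e dV hdV dW hdW) * h)) : ℂˣ) : ℂ) * stdExtension 𝒦 ((((3 : ℕ) : ℂ) - (n : ℂ)) / 2) G s ((((Quotient.out (q : SiegelDeltaQuot L e dV hdV dW hdW) : ratH L e dV hdV dW hdW) : HA L e dV hdV dW hdW)) * ((u : HA L e dV hdV dW hdW) * h))) ∂νN)) ∧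
          ((r : ℝ≥0) ≠ 1) ∧ (c₇ ≠ 1) ∧
          (∀ s : ℂ, (n : ℝ) / 2 < s.re → ∀ p : HA L e dV hdV dW hdW, blk L e dV hdV dW hdW p =
            cayR (AdeleRing (𝓞 L) L) (Fin n) *
          Matrix.fromBlocks (((posRealIdele L r : (AdeleRing (𝓞 L) L)ˣ) : AdeleRing (𝓞 L) L) • (1 : Matrix (Fin n) (Fin n) (AdeleRing (𝓞 L) L))) 0 0
            ((((posRealIdele L r)⁻¹ : (AdeleRing (𝓞 L) L)ˣ) : AdeleRing (𝓞 L) L) • (1 : Matrix (Fin n) (Fin n) (AdeleRing (𝓞 L) L))) *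
          cayRinv (AdeleRing (𝓞 L) L) (Fin n) → ∀ h, E₇ s (p * h) = c₇ * E₇ s h) := by
  classical
  -- the frame has `n = 2`: make it literal
  obtain rfl : n = 2 := by
    have h2 : Fintype.card (Fin 2 × Fin 1) = Fintype.card (Fin n) := Fintype.card_congr e
    simp only [Fintype.card_prod, Fintype.card_fin] at h2
    omega
  -- ★ (K0c): the organ outputs `E₈`, `E₇` with (i)(iv) at the prefix `{½}`
  obtain ⟨E₈, E₇, h8d, h8eq, h7d, h7eq⟩ := exists_constantTerm_package_incoherent L e dV hdV hdV0 dW hdW hdW0 χ hχ 𝒦 h𝒦 χb hχbu hχbs α hα hαrat hχD eW e' dV₀ hdV₀ hdV₀0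
    S hχS hKS G hINC νN β hβ hK hβK wq hS₈ hur P₈ hPS I₈ TF q hq A₈ hA₈ c₈ hc₈ N₈ hN₈ hB S₇ γl hγ0 hγ1 W hWstab hWlaw hWlev hWcont hWext φ hφT hφN hφW hφhol hφbd
    mx hC₀ hA₀ hmx γ₇ hγ c₀ hMID ({(1 / 2 : ℂ)} : Finset ℂ) (Finset.mem_singleton_self _)
  -- ★ G3: `g_{S,G}` is a family of continuous Siegel sections for `χ` (read along `hχD`)
  have hstd := isStandardSectionFamily_incoherentFamily L e dV hdV hdV0 dW hdW hdW0 eW e' dV₀ hdV₀ hdV₀0 (by norm_num) h𝒦 hχbu hχbs S hχS hKS α hα hαrat G hINC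
  rw [hχD] at hstd
  obtain ⟨hst, hgc⟩ := hstd
  -- the (M) frame letters, built here: the middle reflection `g₀`, a Levi homomorphism `Λ`, the stabiliser `Γ₀ = Stab(⟦w₀⟧)`
  obtain ⟨g₀, hg₀, -⟩ := exists_reflStd L e dV dW
  obtain ⟨Λ, hΛ⟩ := exists_leviHom_blk_eq L e dV hdV dW hdW hdV0 hdW0
  obtain ⟨Γ₀, -, hΓ₀⟩ := exists_stabilizer_subgroupOf (unipDelta L e dV hdV dW hdW)
    (⟨iotaGG L e dV hdV dW hdW (1, UnitaryGroup.rationalPairToAdelic (Fp L) L (IsCMField.complexConj L) 2 1 (Matrix.diagonal dV) (Matrix.diagonal dW) g₀),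
      iotaGG_one_mem_ratH L e dV hdV dW hdW g₀⟩ : ratH L e dV hdV dW hdW)
  -- the ray parameter `r := 2` and the eigenvalue `c₇ := |z(2)|_𝔸 = 2^{[L:ℚ]}`
  have hd : Module.finrank ℚ L ≠ 0 := (Module.finrank_pos (R := ℚ) (M := L)).ne'
  refine ⟨E₈, E₇, Units.mk0 (2 : ℝ≥0) two_ne_zero, ((IdeleClassGroup.ideleNorm L (posRealIdele L (Units.mk0 (2 : ℝ≥0) two_ne_zero)) : ℝ) : ℂ),
    h8d, h8eq, h7d, h7eq, ?_, ?_, fun s hs p hp h => ?_⟩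
  · rw [Units.val_mk0]; norm_num
  · rw [ideleNorm_posRealIdele_holds L, Units.val_mk0, NNReal.coe_pow, NNReal.coe_ofNat]
    exact_mod_cast (one_lt_pow₀ (by norm_num : (1 : ℝ) < 2) hd).ne'
  · -- `hray₇`: ★ (M) glued through (iv)₇
    have hs1 : 1 < s.re := by rw [Nat.cast_ofNat] at hs; linarith
    have hM := middleTerm_centralRay hg₀ Λ hΛ Γ₀ hΓ₀ wq hwq hdV0 hdW0 νN hβ hβtop hK hβK hχ hs1 (hst.1.1 s) (hgc s) (Units.mk0 (2 : ℝ≥0) two_ne_zero) hp h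
    dsimp only at hM
    rw [h7eq s (p * h) hs, h7eq s h hs, Complex.real_smul, Complex.real_smul, hM]
    ring

end Summit.HodgeConjecture.HodgeConjecture.Cruxes.HLiu418.K2LiuIncoherentKindZeroOutputsOfRecord

end
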